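/-
Origin: expansion seat `planner-pub-hodgecm-mc-axioms-1-g14-0`, handover #W176 2026-08-20T15:53:55Z md5 c03d2233b502 (PKG 9af3f88bcbb5 → c03d2233b502; 65 l.; MECHANICAL (iib-R) rewrite v3.1 of the PKG file as it stands (9 token edits; rules R1x1+RX[h₂']x8)) (`HOME/mc/pub-hodgecm-mc-axioms-1-g14/revendor/kit-r55/stage55/HodgeCM/Model/Sanity/DegenerateClosureEmpty.lean`, md5 c03d2233b502, 65 lines);
landed by the gen-22 packager (p-g22) in gate run 55 REPLACES the earlier landed copy of `HodgeCM/Model/Sanity/DegenerateClosureEmpty.lean` (seat copy carried the packager Origin header of an earlier run (stripped)).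
-/
/-
Origin: SANITY lane `planner-pub-hodgecm-mc-sanity-1-g5-0` (unit pub-hodgecm-mc-sanity-1-g5, gen 5 of mc-sanity-1,
node SAN-15b), 2026-08-19.  NEW additive KERNEL leaf `HodgeCM/Model/Sanity/DegenerateClosureEmpty.lean`: the one-line
corollary joining this lane's `Sanity/DegenerateClosure` (SAN-15, RUN-34 row #2, 68a4d704dad7) with prl1-g15's
`Model/GoodSexticWitness` (RUN-34 row, 11db217be127).  Install AFTER both; nothing imports it.
KERNEL: 0 records, 0 `Prop` definitions, 0 hypotheses minted, nothing cited, no instances.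
Expected `#print axioms`: ⊆ {propext, Classical.choice, Quot.sound}.
-/
import Summits.HodgeConjecture.HodgeCM.Model.GoodSexticWitness
import Summits.HodgeConjecture.HodgeCM.Model.Sanity.DegenerateClosure

/-!
# SAN-15b — the toy closure of E has an EMPTY hypothesis type

`Sanity/DegenerateClosure` showed that E R10/R13 over the degenerate data (`S := degS`, `W := zeroSK ∘ W`) closes
`(picardCMUniverse …).PerL` modulo the single data binder `CdegS`, and that `Nonempty CdegS ↔ NoGoodSextic` (the
vacuity residual).  prl1-g15's `Model.not_noGoodSextic₀` (over `Model.PerLInhabited`: an honest anisotropic good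
seesaw context of degree 6 exists in kernel, for ANY model data, since `GoodCtx` reads the model only through the
sign recipe) refutes that residual.  Hence, unconditionally: **`CdegS` is EMPTY** — the kernel certificate that E
cannot be closed on degenerate data; its content binder `C` rejects the toys at an honest context.
Census device only (MODEL-N ±0); the E term of record and its binder accounting are unchanged.
-/

set_option autoImplicit false

noncomputable section

namespace HodgeCM
namespace Model
namespace Sanity

open Literature.AlgebraicGeometry.HodgeTheory Literature.NumberTheory.Automorphic.PicardCM
open Literature.NumberTheory.Transcendental (Arapura2012_Cor_15_4_6)
open Literature.AlgebraicGeometry.ShimuraVarieties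

variable (hHD : exists_isReal_hodgeModel) (hI : hodgePQ_independent_of_hodgeModel)
  (h₁ : BallQuotientUniformised)  (h₃ : CMAbelianVarietyRealised)

/-- **The vacuity residual is FALSE** for E's model over the degenerate data (prl1-g15 `Model.not_noGoodSextic₀`). -/
theorem not_noGoodSextic (h : Bool) (hA : Arapura2012_Cor_15_4_6)
    (W : ∀ {L : CMField} {ι₁ : L →+* ℂ} (V : HermSpace3 L ι₁) (c : SeesawCtx L), WmInput V c.D)
    (μ : ∀ {L : CMField}, SeesawCtx L → Fin 4 → NumberField.InfinitePlace L → ℤ) :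
    ¬ NoGoodSextic hHD hI h₁ h₃ h hA W μ :=
  not_noGoodSextic₀ hHD hI h₁ h₃ h (embOf hHD hI h₁ h₃) (coverOf hHD hI h₁ h₃ hA)
    (wmOfInput fun V c => (W V c).zeroSK)
    (thetaOf _ (thetaClassInputOf _ (fun V c => thetaSpaceInputOf hHD hI h₁ h₃ degS V c))) (d12Of μ) (d34Of μ)

/-- **`CdegS` is EMPTY**: the hypothesis type of the toy closures `perL_r10core_degS` / `perL_r13core_degS` has no
inhabitant, for every `h hA W μ` — E cannot be closed on degenerate data. -/
theorem isEmpty_CdegS (h : Bool) (hA : Arapura2012_Cor_15_4_6)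
    (W : ∀ {L : CMField} {ι₁ : L →+* ℂ} (V : HermSpace3 L ι₁) (c : SeesawCtx L), WmInput V c.D)
    (μ : ∀ {L : CMField}, SeesawCtx L → Fin 4 → NumberField.InfinitePlace L → ℤ) :
    IsEmpty (CdegS hHD hI h₁ h₃ h hA W μ) :=
  ⟨fun C => not_noGoodSextic hHD hI h₁ h₃ h hA W μ
    ((nonempty_CdegS_iff_noGoodSextic hHD hI h₁ h₃ h hA W μ).1 ⟨C⟩)⟩

end Sanity
end Model
end HodgeCM

end
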